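import Mathlib
import Summits.MatrixMultiplication.MatrixMultiplication.Theorems.SubgroupIdentityDesigns.Negative.Fixers
import Summits.MatrixMultiplication.MatrixMultiplication.Theorems.SubgroupIdentityDesigns.Negative.CellStatus

/-!
# Every member of a `(2,1)` level-one witness has a free vector (all `p`)

Route `LevelGradedCohnUmans`, crux `SubgroupIdentityDesigns`, the `(m,k) = (2,1)` cell.
`levelOne_witness_free_vector`: if `(H₁, H₂, H₃)` is a level-one witness at `0 < ε ≤ 1`
(`SubgroupTPP`, a level-`1` identity design, and the crux inequality
`budget p 2 1 (2+ε) < (|H₁||H₂||H₃|)^{(2+ε)/3}`, `p ≥ 3`), then EACH member `Hᵢ` has a non-zero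
vector with trivial stabiliser: `∃ a ≠ 0, ∀ h ∈ Hᵢ, h a = a → h = 1` (a regular orbit on `𝔽_p² ∖ 0`).
Proof: the members are `p`-free (`levelOne_witness_pfree_profile`, CellStatus) and a `p`-free member
in which every non-zero vector has a non-trivial fixer kills the design
(`no_levelOne_design_of_fixers_memᵢ`, Fixers).  By the character-certificate census (kit j123653 /
j124131, exact) this is, for `p ≤ 13`, precisely the statement that no member is single-member
certifiable; it is the structural form of every single-member exclusion of this cell.
VALUE = THEOREM, NOT summit progress; the crux item stmt-MatrixMultiplication-14079 is untouched and
remains open.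
-/

set_option linter.dupNamespace false

noncomputable section

open scoped BigOperators Classical

open Summit.MatrixMultiplication.MatrixMultiplication.Theorems.LieRankDesigns.Negative (GLm Mat budget)

open Literature.Barriers.MatrixMultiplication (SubgroupTPP)

namespace Summit.MatrixMultiplication.MatrixMultiplication.Theorems.SubgroupIdentityDesigns.Negative

section WitnessFreeVector

variable {p : ℕ} [hp : Fact p.Prime]

/-- **Every member of a `(2,1)` level-one witness has a free vector.**  All `p`. -/
theorem levelOne_witness_free_vector (hp3 : 3 ≤ p) {ε : ℝ} (hε : 0 < ε) (hε1 : ε ≤ 1)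
    {H₁ H₂ H₃ : Subgroup (GLm p 2)} (htpp : SubgroupTPP H₁ H₂ H₃)
    (hdesign : ∃ c : Mat p 2 → ℂ, (∀ M, 1 < M.rank → c M = 0) ∧
      (∑ M, c M * ZMod.stdAddChar (Matrix.trace (M * ((1 : GLm p 2) : Mat p 2)))) = 1 ∧
      ∀ a ∈ H₁, ∀ b ∈ H₂, ∀ g ∈ H₃, a * b * g ≠ 1 →
        (∑ M, c M *
          ZMod.stdAddChar (Matrix.trace (M * ((a * b * g : GLm p 2) : Mat p 2)))) = 0)
    (hwit : budget p 2 1 (2 + ε) <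
      ((Nat.card H₁ * Nat.card H₂ * Nat.card H₃ : ℕ) : ℝ) ^ ((2 + ε) / 3)) :
    (∃ a : Fin 2 → ZMod p, a ≠ 0 ∧ ∀ h ∈ H₁, ((h : GLm p 2) : Mat p 2).mulVec a = a → h = 1) ∧
    (∃ a : Fin 2 → ZMod p, a ≠ 0 ∧ ∀ h ∈ H₂, ((h : GLm p 2) : Mat p 2).mulVec a = a → h = 1) ∧
    (∃ a : Fin 2 → ZMod p, a ≠ 0 ∧ ∀ h ∈ H₃, ((h : GLm p 2) : Mat p 2).mulVec a = a → h = 1) := by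
  obtain ⟨-, hK₁, hK₂, hK₃⟩ := levelOne_witness_pfree_profile hp3 hε hε1 htpp hdesign hwit
  refine ⟨?_, ?_, ?_⟩
  · by_contra h
    push Not at h
    exact no_levelOne_design_of_fixers_mem₁ (H₂ := H₂) (H₃ := H₃) H₁ le_rfl hK₁
      (fun a ha => by
        obtain ⟨s, hs, hsa, hs1⟩ := h a ha
        exact ⟨s, hs, hs1, hsa⟩) hdesign
  · by_contra h
    push Not at h
    exact no_levelOne_design_of_fixers_mem₂ (H₁ := H₁) (H₃ := H₃) H₂ le_rfl hK₂
      (fun a ha => by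
        obtain ⟨s, hs, hsa, hs1⟩ := h a ha
        exact ⟨s, hs, hs1, hsa⟩) hdesign
  · by_contra h
    push Not at h
    exact no_levelOne_design_of_fixers_mem₃ (H₁ := H₁) (H₂ := H₂) H₃ le_rfl hK₃
      (fun a ha => by
        obtain ⟨s, hs, hsa, hs1⟩ := h a ha
        exact ⟨s, hs, hs1, hsa⟩) hdesign

/-- A subgroup with a free vector `a` embeds into the non-zero vectors via `h ↦ h a`. -/
theorem orbitMap_injective_of_free (H : Subgroup (GLm p 2)) (a : Fin 2 → ZMod p)
    (hfree : ∀ h ∈ H, ((h : GLm p 2) : Mat p 2).mulVec a = a → h = 1) :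
    Function.Injective fun h : H => ((h : GLm p 2) : Mat p 2).mulVec a := by
  intro x y hxy
  have hxy' : (((x : H) : GLm p 2) : Mat p 2).mulVec a = (((y : H) : GLm p 2) : Mat p 2).mulVec a :=
    hxy
  have hx : ((((x : H) : GLm p 2)⁻¹ : GLm p 2) : Mat p 2).mulVec
      ((((x : H) : GLm p 2) : Mat p 2).mulVec a) = a := by
    rw [Matrix.mulVec_mulVec, ← Units.val_mul, inv_mul_cancel, Units.val_one, Matrix.one_mulVec]
  have hq : ((((x : H) : GLm p 2)⁻¹ * ((y : H) : GLm p 2) : GLm p 2) : Mat p 2).mulVec a = a := by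
    rw [Units.val_mul, ← Matrix.mulVec_mulVec, ← hxy', hx]
  have h1 : ((x : H) : GLm p 2)⁻¹ * ((y : H) : GLm p 2) = 1 :=
    hfree _ (H.mul_mem (H.inv_mem x.2) y.2) hq
  rw [inv_mul_eq_one] at h1
  exact Subtype.ext h1

/-- **Corollary: every member of a level-one witness embeds into `𝔽_p² ∖ 0`** via `h ↦ h a` for
its free vector `a` (a regular orbit); in particular no member is transitive-free-excluded only by
volume. -/
theorem levelOne_witness_orbit_injective (hp3 : 3 ≤ p) {ε : ℝ} (hε : 0 < ε) (hε1 : ε ≤ 1)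
    {H₁ H₂ H₃ : Subgroup (GLm p 2)} (htpp : SubgroupTPP H₁ H₂ H₃)
    (hdesign : ∃ c : Mat p 2 → ℂ, (∀ M, 1 < M.rank → c M = 0) ∧
      (∑ M, c M * ZMod.stdAddChar (Matrix.trace (M * ((1 : GLm p 2) : Mat p 2)))) = 1 ∧
      ∀ a ∈ H₁, ∀ b ∈ H₂, ∀ g ∈ H₃, a * b * g ≠ 1 →
        (∑ M, c M *
          ZMod.stdAddChar (Matrix.trace (M * ((a * b * g : GLm p 2) : Mat p 2)))) = 0)
    (hwit : budget p 2 1 (2 + ε) <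
      ((Nat.card H₁ * Nat.card H₂ * Nat.card H₃ : ℕ) : ℝ) ^ ((2 + ε) / 3)) :
    (∃ a : Fin 2 → ZMod p, a ≠ 0 ∧
      Function.Injective fun h : H₁ => ((h : GLm p 2) : Mat p 2).mulVec a) ∧
    (∃ a : Fin 2 → ZMod p, a ≠ 0 ∧
      Function.Injective fun h : H₂ => ((h : GLm p 2) : Mat p 2).mulVec a) ∧
    (∃ a : Fin 2 → ZMod p, a ≠ 0 ∧
      Function.Injective fun h : H₃ => ((h : GLm p 2) : Mat p 2).mulVec a) := by
  obtain ⟨⟨a₁, ha₁, h₁⟩, ⟨a₂, ha₂, h₂⟩, ⟨a₃, ha₃, h₃⟩⟩ :=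
    levelOne_witness_free_vector hp3 hε hε1 htpp hdesign hwit
  exact ⟨⟨a₁, ha₁, orbitMap_injective_of_free H₁ a₁ h₁⟩,
    ⟨a₂, ha₂, orbitMap_injective_of_free H₂ a₂ h₂⟩,
    ⟨a₃, ha₃, orbitMap_injective_of_free H₃ a₃ h₃⟩⟩

end WitnessFreeVector

end Summit.MatrixMultiplication.MatrixMultiplication.Theorems.SubgroupIdentityDesigns.Negative
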